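import Literature.IUT.HodgeArakelov.ThetaSettingCompletionPackage
import Literature.AnabelianGeometry.SemiGraphs.TemperedCompletionExistence
import Literature.IUT.HodgeTheaters.ProfiniteCompletionRestrictOpen
import Literature.AnabelianGeometry.EtaleTheta.Discharge.Sec5ThetaSubquotientOfDoubleUnderline
import Literature.AnabelianGeometry.EtaleTheta.Discharge.Sec2CompletionIndex
import Literature.AnabelianGeometry.EtaleTheta.SettingModelTateGroupLevel
import Literature.AnabelianGeometry.EtaleTheta.SettingModelTateDoubleUnderline
import HarnessLib

/-!
# `Δ_E` of the named completion package IS the profinite completion of `Δ^{(S)}`; identification of `Δ_E`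
# with an open subgroup of `Δ_X = (Δ^tp_X)^∧` (genuine setting) and of `F̂₂` (stage-2 Tate model)

Mochizuki, *Semi-graphs of anabelioids*, Publ. RIMS **42** (2006) [SemiAnbd], §6 p. 69 ("we shall write
`Π_{X_K} := (Π^temp_{X_K})^∧`; `Δ_X := (Δ^temp_X)^∧`", "the profinite completion") and p. 73 ("the `∧` denotes
profinite completion, or, EQUIVALENTLY, closure in `Π_{X_K}`") [cite: MochizukiSemiAnbd2006, §6 p.69, p.73];
S. Mochizuki, *Inter-universal Teichmüller theory II*, §1, Example 1.8 (i) (kurims p. 35) — the subgroup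
`Δ ⊆ Π` of the [IUTchII] §1 setting [claim: Mochizuki2012, status: disputed]; [EtTh] §2 Def. 2.5 / Rmk 2.3.1
(`Π^tp_{X̲̲} ⊆ Π^tp_X` open of index `l²`) [cite: MochizukiEtTh2009, Rmk 2.3.1 p.38].

Abc-iut cell, seat abc-iut-L6-t19 (gen 9), row «(ii-b)-IDENT» of W1 «MCHAR-VIA-PROJECTIVITY (ii-b)» (abc-iut-L6-lead
§F v1.19co/cw/cx; split proposed by the W1 holder abc-iut-w4-d044, whose file A
`ThetaSettingDeltaCharacteristicOfCentralizer.lean` (p483847) consumes the model-level output below through its binder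
`(U) (hU : IsOpen U) (eΔ : Δ_E ≃ₜ* U)`).  SIBLING FILE: abc-iut-w4-d044's `ThetaSettingCompletionPackageGeomIdent.lean` (p486362)
reaches the same model-level binder by a `Π`-level route (uniqueness between `S.completionMap` and `toHatχq|_{Π^tp_{X̲̲}}`)
at `K := D.K`, `eK := galoisIdentification`; THIS file is the `Δ`-level route — its §1–§2 are GENERIC (every [IUTchII] §1
setting / every genuine [EtTh] setting with tempered Galois-countable `Π^tp_X`), which the sibling does not cover, and
its model corollary (§3/§4) is stated for ANY `K`, `eK`.  PROOF-ONLY (no definition, no instance, no named fact); consumes BY NAME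
abc-iut-w5-d233's named package (`ThetaSetting.completionPackage`, `deltaCompletionMap`,
`geom_completionPackage_eq_topologicalClosure`, `denseRange_deltaCompletionMap`, `deltaXEquivSubgroupOf`), the
`IsProfiniteCompletion` API of abc-iut-L2-d1 / abc-iut-w5-d139 (`exists_openNormal_le`,
`isOpen_topologicalClosure_map`, `nonempty_continuousMulEquiv`), abc-iut-L5-t11's
`ProfiniteCompletionRestrict.isProfiniteCompletion_restrict`, abc-iut-w5-d139's
`TemperedCurve.isProfiniteCompletion_deltaToHat_of_isTempered`, abc-iut-L2-t8's `isOpen_Huu_subgroupOf_deltaTemp` /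
`index_Huu_subgroupOf_deltaTemp` (`Discharge/Sec2CompletionIndex.lean`), and the stage-2 Tate model files of
abc-iut-w5-d249 / abc-iut-w5-d111 (`curveχq`, `deltaHatχqEquiv`, `isTempered_PiTpχq`, `secondCountableTopology_PiTpχq`).

WHAT IS SHOWN.
§1 (any [IUTchII] §1 setting `S` with `eK : G_k ⥲ Gal(K̄/K)`; `E := S.completionPackage K eK`):
* `ThetaSetting.isProfiniteCompletion_deltaCompletionMap` — **`ι|_Δ : Δ^{(S)} → Δ_E` IS A PROFINITE COMPLETION**
  as soon as `aug_S` is an open map and `Π^{(S)}` is tempered: the package-level twin of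
  `TemperedCurve.isProfiniteCompletion_deltaToHat_of_isTempered` ([SemiAnbd] p. 73 "profinite completion, or,
  equivalently, closure").  Mechanism (classical, verbatim from the curve-level file): an open normal finite-index
  `U ⊴ Δ^{(S)}` contains `N ∩ Δ^{(S)}` for an open normal `N ⊴ Π^{(S)}` (temperedness); `U·N` is open OF FINITE
  INDEX in `Π^{(S)}` because `aug_S(N)` is open, hence of finite index, in the compact `G_k`; the completion axiom
  for `ι : Π^{(S)} → Π_E` yields an open normal `V' ⊴ Π_E` with `ι⁻¹(V') ≤ U·N`, and `(ι(U)·V') ∩ Δ_E` is the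
  required open normal subgroup of `Δ_E` (normal because `Δ_E` is the CLOSURE of `ι(Δ^{(S)})`,
  `geom_completionPackage_eq_topologicalClosure`);
* `ThetaSetting.exists_geom_continuousMulEquiv_of_isProfiniteCompletion` — hence `Δ_E` is identified, over
  `Δ^{(S)}`, with ANY profinite completion of `Δ^{(S)}` (uniqueness of profinite completions).
§2 (the GENUINE setting `ofDoubleUnderline` / `EtaleLevels.setting` of `X̲̲_K` over an [EtTh] §1 theta setting
  `D` with `Π^tp_X` tempered and Galois-countable):
* `ThetaSetting.exists_geom_equiv_closure_ofDoubleUnderline` — **`Δ_E ≃ₜ*` the closure `Δ_{X̲̲}` of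
  `ι(Π^tp_{X̲̲} ∩ Δ^tp_X)` in `Δ_X`**, an OPEN subgroup of `Δ_X` (`isOpen_closure_map_deltaToHat_ofDoubleUnderline`),
  compatibly with `ι` — i.e. `(Δ^tp_{X̲̲})^∧ = Δ_{X̲̲} ≤ Δ_X` ([SemiAnbd] §6: "replacing `X` by a finite étale
  covering").
§3 (the stage-2 Tate model `D := ThetaSetting.modelχq p i j`, every `(i, j)`, where `Δ_X ≃ₜ* F̂₂` by
  `deltaHatχqEquiv`):
* `ThetaSetting.exists_geom_equiv_isOpen_freeProfinite_modelχq` / `EtaleLevels.exists_geom_equiv_isOpen_freeProfinite_modelχq`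
  — **`∃ U ≤ F̂₂` open with `Δ_E ≃ₜ* U`**, for ANY `K`, `eK`: the binder `(U) (hU) (eΔ)` of abc-iut-w4-d044's
  `ThetaSetting.deltaX_characteristic_of_centralizer` at the model, with NO hypothesis (the sibling p486362's
  `SettingModel.exists_geom_completionPackage_equiv_isOpen` is the instance `K := D.K`, `eK := galoisIdentification`, by the
  `Π`-level route).

HONEST FRAMING: classical profinite group theory over OUR typed interfaces plus OUR semi-synthetic stage-2 model
(binder-discharge evidence for the typed interface, not the tempered `π₁` of a curve); nothing of [SemiAnbd]/[EtTh]
beyond the definitions is asserted; nothing here bears on [IUTchIII] Cor. 3.12 or takes a side; typed ≠ proved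
elsewhere; instantiated ≠ endorsed; nothing asserts abc proved or refuted.
-/

noncomputable section

namespace Literature.IUT.HodgeArakelov

open Literature.AnabelianGeometry.AbsoluteAnabelian
open Literature.AnabelianGeometry.SemiGraphs
open _root_.Topology

/-! ### §0. Transport of `IsProfiniteCompletion` along an isomorphism of the source -/

/-- Precomposing a profinite completion `ι : F → F̂` with an isomorphism of topological groups `e : F' ⥲ F`
gives a profinite completion of `F'` (all clauses transport through `e`; the self-isomorphism case is
abc-iut-L4's `IsProfiniteCompletion.comp_continuousMulEquiv`). [cite: MochizukiSemiAnbd2006, §6 p.69] -/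
theorem isProfiniteCompletion_comp_continuousMulEquiv {F F' Fhat : Type*} [Group F] [TopologicalSpace F]
    [Group F'] [TopologicalSpace F'] [Group Fhat] [TopologicalSpace Fhat] {ι : F →ₜ* Fhat}
    (hι : IsProfiniteCompletion ι) (e : F' ≃ₜ* F) :
    IsProfiniteCompletion (ι.comp (e : F' →ₜ* F)) := by
  refine ⟨hι.compactSpace, hι.t2Space, hι.totallyDisconnectedSpace, ?_, ?_, ?_⟩
  · -- dense range: `e` is surjective
    have happ : ∀ x : F', (ι.comp (e : F' →ₜ* F)) x = ι (e x) := fun x => rfl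
    have hr : Set.range (ι.comp (e : F' →ₜ* F)) = Set.range ι := by
      ext z
      constructor
      · rintro ⟨x, rfl⟩
        exact ⟨e x, (happ x).symm⟩
      · rintro ⟨x, rfl⟩
        exact ⟨e.symm x, by rw [happ, e.apply_symm_apply]⟩
    change Dense (Set.range _)
    rw [hr]
    exact hι.denseRange
  · -- open normal finite-index subgroups of `F'` are preimages: transport through `e`
    intro U hU
    haveI : (U.toSubgroup.map e.toMulEquiv.toMonoidHom).Normal :=
      Subgroup.Normal.map inferInstance _ e.surjective
    let U' : OpenNormalSubgroup F :=
      { toSubgroup := U.toSubgroup.map e.toMulEquiv.toMonoidHom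
        isOpen' := by
          change IsOpen ((U.toSubgroup.map e.toMulEquiv.toMonoidHom : Subgroup F) : Set F)
          rw [Subgroup.coe_map]
          exact e.toHomeomorph.isOpenMap _ U.isOpen' }
    have hU' : U'.toSubgroup.FiniteIndex := by
      change (U.toSubgroup.map e.toMulEquiv.toMonoidHom).FiniteIndex
      constructor
      rw [Subgroup.index_map_of_bijective (f := e.toMulEquiv.toMonoidHom) e.bijective]
      exact hU.index_ne_zero
    obtain ⟨V, hV⟩ := hι.comap_surjective U' hU'
    refine ⟨V, ?_⟩
    ext x
    constructor
    · intro h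
      have hx : e x ∈ U'.toSubgroup := ⟨x, h, rfl⟩
      rw [hV] at hx
      exact hx
    · intro h
      have hx : e x ∈ U'.toSubgroup := by
        rw [hV]
        exact h
      obtain ⟨y, hy, hyx⟩ := hx
      rwa [← e.injective hyx]
  · intro V
    have h := hι.isOpen_comap V
    have hc : ((V.toSubgroup.comap (ι.comp (e : F' →ₜ* F)).toMonoidHom : Subgroup F') : Set F') =
        e ⁻¹' (V.toSubgroup.comap ι.toMonoidHom : Set F) := rfl
    rw [hc]
    exact h.preimage e.continuous

namespace ThetaSetting

/-! ### §1. `ι|_Δ : Δ^{(S)} → Δ_E` is a profinite completion (open `aug_S`, tempered `Π^{(S)}`) -/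

section Package

variable (S : ThetaSetting.{0}) (K : Type) [Field K] [CharZero K] (eK : S.Gk ≃ₜ* Field.absoluteGaloisGroup K)

/-- For an OPEN augmentation onto a COMPACT `G_k`, the image of an open normal subgroup of `Π^{(S)}` has finite
index in `G_k`. [cite: MochizukiSemiAnbd2006, §6 p.69] -/
theorem finiteIndex_map_aug (hopen : IsOpenMap S.aug) [CompactSpace S.Gk] (N : OpenNormalSubgroup S.PiX) :
    (N.toSubgroup.map S.aug).FiniteIndex := by
  have hopen' : IsOpen ((N.toSubgroup.map S.aug : Subgroup S.Gk) : Set S.Gk) := by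
    rw [Subgroup.coe_map]
    exact hopen _ N.toOpenSubgroup.isOpen
  haveI : Finite (S.Gk ⧸ (N.toSubgroup.map S.aug)) := Subgroup.quotient_finite_of_isOpen _ hopen'
  exact Subgroup.finiteIndex_of_finite_quotient

/-- Hence `Δ^{(S)} · N` has finite index in `Π^{(S)}` for every open normal `N ⊴ Π^{(S)}`.
[cite: MochizukiSemiAnbd2006, §6 p.69] -/
theorem finiteIndex_deltaX_sup (hopen : IsOpenMap S.aug) [CompactSpace S.Gk] (N : OpenNormalSubgroup S.PiX) :
    (S.DeltaX ⊔ N.toSubgroup).FiniteIndex := by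
  haveI := S.finiteIndex_map_aug hopen N
  have h : S.DeltaX ⊔ N.toSubgroup = (N.toSubgroup.map S.aug).comap S.aug := by
    show S.aug.ker ⊔ N.toSubgroup = _
    rw [Subgroup.comap_map_eq, sup_comm]
  rw [h]
  refine ⟨?_⟩
  rw [Subgroup.index_comap_of_surjective _ S.aug_surjective]
  exact Subgroup.FiniteIndex.index_ne_zero

/-- **The completion axiom for `ι|_Δ : Δ^{(S)} → Δ_E`** (package-level twin of
`TemperedCurve.exists_openNormal_comap_deltaToHat_eq_of_isTempered`): for `aug_S` open, `Π^{(S)}` tempered and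
`G_k` compact, every open normal subgroup `U ⊴ Δ^{(S)}` of finite index is cut out by an open normal subgroup of
`Δ_E`.  See the module docstring for the mechanism. [cite: MochizukiSemiAnbd2006, §6 p.73] -/
theorem exists_openNormal_comap_deltaCompletionMap_eq (hopen : IsOpenMap S.aug) (hT : IsTempered S.PiX)
    [CompactSpace S.Gk] (U : OpenNormalSubgroup S.DeltaX) (hU : U.toSubgroup.FiniteIndex) :
    ∃ V : OpenNormalSubgroup (S.completionPackage K eK).geom,
      U.toSubgroup = V.toSubgroup.comap (S.deltaCompletionMap K eK).toMonoidHom := by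
  classical
  have hι := S.isProfiniteCompletion_completionMap
  haveI : CompactSpace S.completionArith := hι.compactSpace
  have hgeom := S.geom_completionPackage_eq_topologicalClosure K eK hopen
  -- Step 1: an open normal `N ⊴ Π^{(S)}` with `N ∩ Δ^{(S)} ⊆ U`
  have hU1 : ((U.toOpenSubgroup : OpenSubgroup S.DeltaX) : Set S.DeltaX) ∈ 𝓝 (1 : S.DeltaX) :=
    U.toOpenSubgroup.mem_nhds_one
  obtain ⟨O, hO, hOU⟩ := (mem_nhds_subtype _ _ _).1 hU1
  obtain ⟨N, -, hNO⟩ := hT.basis O (by simpa using hO)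
  have hNU : ∀ g : S.DeltaX, (g : S.PiX) ∈ N → g ∈ U := fun g hg => hOU (hNO hg)
  -- Step 2: `U₀ := U ≤ Π^{(S)}` and `U' := U₀ ⊔ N`
  set U₀ : Subgroup S.PiX := U.toSubgroup.map S.DeltaX.subtype with hU₀
  have hU₀le : U₀ ≤ S.DeltaX := fun g ⟨u, _, hu⟩ => hu ▸ u.2
  set U' : Subgroup S.PiX := U₀ ⊔ N.toSubgroup with hU'
  have hNU' : N.toSubgroup ≤ U' := le_sup_right
  have hU'open : IsOpen (U' : Set S.PiX) := Subgroup.isOpen_mono hNU' N.toOpenSubgroup.isOpen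
  -- `U' ∩ Δ^{(S)} ⊆ U₀`
  have hU'Δ : ∀ g ∈ U', g ∈ S.DeltaX → g ∈ U₀ := by
    intro g hg hgΔ
    have hg' : g ∈ ((U₀ ⊔ N.toSubgroup : Subgroup S.PiX) : Set S.PiX) := hg
    rw [Subgroup.mul_normal] at hg'
    obtain ⟨u, hu, n, hn, rfl⟩ := Set.mem_mul.1 hg'
    have hnΔ : n ∈ S.DeltaX := by
      have := S.DeltaX.mul_mem (S.DeltaX.inv_mem (hU₀le hu)) hgΔ
      simpa using this
    have hnU : (⟨n, hnΔ⟩ : S.DeltaX) ∈ U := hNU ⟨n, hnΔ⟩ hn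
    exact U₀.mul_mem hu ⟨⟨n, hnΔ⟩, hnU, rfl⟩
  -- `U'` has finite index in `Π^{(S)}`
  haveI hU'fi : U'.FiniteIndex := by
    let π := QuotientGroup.mk' N.toSubgroup
    have hπ : Function.Surjective π := QuotientGroup.mk'_surjective _
    have hU'eq : U' = (U₀.map π).comap π := by
      rw [Subgroup.comap_map_eq, QuotientGroup.ker_mk']
    haveI hΔN : (S.DeltaX ⊔ N.toSubgroup).FiniteIndex := S.finiteIndex_deltaX_sup hopen N
    have hΔbar : (S.DeltaX.map π).index ≠ 0 := by
      rw [← Subgroup.index_comap_of_surjective _ hπ, Subgroup.comap_map_eq, QuotientGroup.ker_mk']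
      exact hΔN.index_ne_zero
    have hle : U₀.map π ≤ S.DeltaX.map π := Subgroup.map_mono hU₀le
    have hrel : (U₀.map π).relIndex (S.DeltaX.map π) ≠ 0 := by
      let φ := π.subgroupMap S.DeltaX
      have hφ : Function.Surjective φ := π.subgroupMap_surjective S.DeltaX
      have hsub : U.toSubgroup.map φ ≤ (U₀.map π).subgroupOf (S.DeltaX.map π) := by
        rintro _ ⟨u, hu, rfl⟩
        rw [Subgroup.mem_subgroupOf]
        exact ⟨(u : S.PiX), ⟨u, hu, rfl⟩, rfl⟩
      have h1 : (U.toSubgroup.map φ).index ≠ 0 :=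
        ne_zero_of_dvd_ne_zero hU.index_ne_zero (U.toSubgroup.index_map_dvd hφ)
      exact ne_zero_of_dvd_ne_zero h1 (Subgroup.index_dvd_of_le hsub)
    rw [hU'eq]
    refine ⟨?_⟩
    rw [Subgroup.index_comap_of_surjective _ hπ, ← Subgroup.relIndex_mul_index hle]
    exact mul_ne_zero hrel hΔbar
  -- Step 3: an open normal `V' ⊴ Π_E` with `ι⁻¹(V') ≤ U'`
  obtain ⟨V', hV'U', -⟩ := IsProfiniteCompletion.exists_openNormal_le hι U' hU'open
  -- Step 4: `W := ι(U₀)·V'`, an open subgroup of `Π_E` normalised by `Δ_E`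
  set W : Subgroup S.completionArith := U₀.map S.completionMap.toMonoidHom ⊔ V'.toSubgroup with hW
  have hV'W : V'.toSubgroup ≤ W := le_sup_right
  have hWopen : IsOpen (W : Set S.completionArith) := Subgroup.isOpen_mono hV'W V'.toOpenSubgroup.isOpen
  have hWclosed : IsClosed (W : Set S.completionArith) := Subgroup.isClosed_of_isOpen _ hWopen
  have hconj : ∀ x ∈ (S.completionPackage K eK).geom, ∀ w ∈ W, x * w * x⁻¹ ∈ W := by
    intro x hx
    have hT : IsClosed {y : S.completionArith | ∀ w ∈ W, y * w * y⁻¹ ∈ W} := by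
      have e : {y : S.completionArith | ∀ w ∈ W, y * w * y⁻¹ ∈ W} =
          ⋂ w ∈ W, (fun y : S.completionArith => y * w * y⁻¹) ⁻¹' (W : Set S.completionArith) := by
        ext y
        simp only [Set.mem_setOf_eq, Set.mem_iInter, Set.mem_preimage, SetLike.mem_coe]
      rw [e]
      exact isClosed_biInter fun w _ => hWclosed.preimage (by fun_prop)
    have hsub : ((S.DeltaX.map S.completionMap.toMonoidHom : Subgroup S.completionArith) :
        Set S.completionArith) ⊆ {y : S.completionArith | ∀ w ∈ W, y * w * y⁻¹ ∈ W} := by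
      rintro _ ⟨δ, hδ, rfl⟩ w hw
      have hw' : w ∈ ((U₀.map S.completionMap.toMonoidHom ⊔ V'.toSubgroup : Subgroup S.completionArith) :
          Set S.completionArith) := hw
      rw [Subgroup.mul_normal] at hw'
      obtain ⟨_, ⟨u, hu, rfl⟩, v, hv, rfl⟩ := Set.mem_mul.1 hw'
      obtain ⟨u', hu', rfl⟩ := hu
      change S.completionMap δ * (S.completionMap (u' : S.PiX) * v) * (S.completionMap δ)⁻¹ ∈ W
      have e : S.completionMap δ * (S.completionMap (u' : S.PiX) * v) * (S.completionMap δ)⁻¹ =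
          S.completionMap (δ * u' * δ⁻¹) * (S.completionMap δ * v * (S.completionMap δ)⁻¹) := by
        simp only [map_mul, map_inv]
        group
      rw [e]
      refine W.mul_mem (Subgroup.mem_sup_left ⟨δ * u' * δ⁻¹, ?_, rfl⟩)
        (Subgroup.mem_sup_right ((inferInstance : V'.toSubgroup.Normal).conj_mem v hv _))
      exact ⟨⟨δ, hδ⟩ * u' * ⟨δ, hδ⟩⁻¹,
        (inferInstance : U.toSubgroup.Normal).conj_mem u' hu' ⟨δ, hδ⟩, rfl⟩
    have hx' : x ∈ closure (((S.DeltaX.map S.completionMap.toMonoidHom : Subgroup S.completionArith)) :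
        Set S.completionArith) := by
      rw [← Subgroup.topologicalClosure_coe, ← hgeom]
      exact hx
    exact hT.closure_subset_iff.2 hsub hx'
  let V : OpenNormalSubgroup (S.completionPackage K eK).geom :=
    { toOpenSubgroup := ⟨W.comap (S.completionPackage K eK).geom.subtype, hWopen.preimage continuous_subtype_val⟩
      isNormal' := ⟨fun n hn g => hconj (g : S.completionArith) g.2 (n : S.completionArith) hn⟩ }
  -- Step 5: `ι|_Δ⁻¹(V) = U`
  refine ⟨V, le_antisymm ?_ ?_⟩
  · intro u hu
    change S.completionMap (u : S.PiX) ∈ W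
    exact Subgroup.mem_sup_left ⟨(u : S.PiX), ⟨u, hu, rfl⟩, rfl⟩
  · intro g hg
    change S.completionMap (g : S.PiX) ∈ W at hg
    have hg' : S.completionMap (g : S.PiX) ∈
        ((U₀.map S.completionMap.toMonoidHom ⊔ V'.toSubgroup : Subgroup S.completionArith) :
          Set S.completionArith) := hg
    rw [Subgroup.mul_normal] at hg'
    obtain ⟨_, ⟨u, hu, rfl⟩, v, hv, hav⟩ := Set.mem_mul.1 hg'
    have hv' : S.completionMap (u⁻¹ * (g : S.PiX)) ∈ V'.toSubgroup := by
      have e : v = (S.completionMap u)⁻¹ * S.completionMap (g : S.PiX) := by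
        rw [← hav]
        change v = (S.completionMap u)⁻¹ * (S.completionMap u * v)
        rw [inv_mul_cancel_left]
      rw [map_mul, map_inv, ← e]
      exact hv
    have h1 : u⁻¹ * (g : S.PiX) ∈ U' := hV'U' hv'
    have h2 : u⁻¹ * (g : S.PiX) ∈ S.DeltaX := S.DeltaX.mul_mem (S.DeltaX.inv_mem (hU₀le hu)) g.2
    have h3 : u⁻¹ * (g : S.PiX) ∈ U₀ := hU'Δ _ h1 h2
    have h4 : (g : S.PiX) ∈ U₀ := by simpa using U₀.mul_mem hu h3
    obtain ⟨g', hg', hgg'⟩ := h4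
    have e : g' = g := Subtype.ext hgg'
    rw [← e]
    exact hg'

/-- **`Δ_E` IS the profinite completion of `Δ^{(S)}`**: for an [IUTchII] §1 setting `S` with OPEN augmentation
and TEMPERED `Π^{(S)}`, and `eK : G_k ⥲ Gal(K̄/K)` (so `G_k` is compact), the corestriction
`ι|_Δ : Δ^{(S)} → Δ_E` of the completion map to the geometric part of the named package `S.completionPackage K eK`
satisfies `IsProfiniteCompletion` ([SemiAnbd] §6 p. 69 "`Δ_X := (Δ^temp_X)^∧`", p. 73 "or, equivalently, closure
in `Π_{X_K}`") — the package-level twin of `TemperedCurve.isProfiniteCompletion_deltaToHat_of_isTempered`.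
[cite: MochizukiSemiAnbd2006, §6 p.73] -/
theorem isProfiniteCompletion_deltaCompletionMap (hopen : IsOpenMap S.aug) (hT : IsTempered S.PiX) :
    IsProfiniteCompletion (S.deltaCompletionMap K eK) := by
  have hι := S.isProfiniteCompletion_completionMap
  haveI : CompactSpace S.completionArith := hι.compactSpace
  haveI : T2Space S.completionArith := hι.t2Space
  haveI : TotallyDisconnectedSpace S.completionArith := hι.totallyDisconnectedSpace
  haveI : CompactSpace S.Gk := eK.toHomeomorph.symm.compactSpace
  have hclosed : IsClosed (((S.completionPackage K eK).geom : Subgroup S.completionArith) :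
      Set S.completionArith) := (S.completionPackage K eK).isClosed_geom
  exact
    { compactSpace := isCompact_iff_compactSpace.1 hclosed.isCompact
      t2Space := inferInstance
      totallyDisconnectedSpace := inferInstance
      denseRange := S.denseRange_deltaCompletionMap K eK hopen
      comap_surjective := fun U hU =>
        S.exists_openNormal_comap_deltaCompletionMap_eq K eK hopen hT U hU
      isOpen_comap := fun V => V.toOpenSubgroup.isOpen.preimage (S.deltaCompletionMap K eK).continuous }

/-- **`Δ_E` is identified, over `Δ^{(S)}`, with ANY profinite completion of `Δ^{(S)}`** (uniqueness of THE
profinite completion, [SemiAnbd] §6 p. 69): for `aug_S` open and `Π^{(S)}` tempered, every profinite completion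
`ι₂ : Δ^{(S)} → P` yields `e : Δ_E ⥲ P` with `e ∘ ι|_Δ = ι₂`. [cite: MochizukiSemiAnbd2006, §6 p.69] -/
theorem exists_geom_continuousMulEquiv_of_isProfiniteCompletion (hopen : IsOpenMap S.aug)
    (hT : IsTempered S.PiX) {P : Type*} [Group P] [TopologicalSpace P] [IsTopologicalGroup P]
    {ι₂ : S.DeltaX →ₜ* P} (h₂ : IsProfiniteCompletion ι₂) :
    ∃ e : (S.completionPackage K eK).geom ≃ₜ* P, ∀ x : S.DeltaX, e (S.deltaCompletionMap K eK x) = ι₂ x :=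
  IsProfiniteCompletion.nonempty_continuousMulEquiv (S.isProfiniteCompletion_deltaCompletionMap K eK hopen hT) h₂

end Package

/-! ### §2. The genuine setting: `Δ_E ≃ Δ_{X̲̲} :=` the closure of `ι(Π^tp_{X̲̲} ∩ Δ^tp_X)` in `Δ_X`, open in `Δ_X` -/

section Genuine

open Literature.AnabelianGeometry.EtaleTheta
open Literature.IUT.HodgeTheaters (ProfiniteCompletionRestrict.isProfiniteCompletion_restrict)
open scoped Literature.AnabelianGeometry.EtaleTheta

variable {p : ℕ} [Fact p.Prime] {D : Literature.AnabelianGeometry.EtaleTheta.ThetaSetting p}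
  {ED : D.EtaleThetaData} {l : ℕ} (C : ED.DoubleUnderline l) {N : ℕ+} (μ : D.CyclotomeMod l N)
  (hC : D.Compat) (hS : D.Sec2Hyps) (hl : l.Prime) (hp2 : p ≠ 2) (hpl : p ≠ l)
  (hζ : ∃ ζ : D.K, IsPrimitiveRoot ζ (4 * l)) {η : (C.thetaEnvData μ hC hS).PiYdd → MuN p N}
  (hη : η ∈ (C.thetaEnvData μ hC hS).thetaCocycles)
  (K : Type) [Field K] [CharZero K]
  (eK : (ofDoubleUnderline C μ hC hS hl hp2 hpl hζ hη).Gk ≃ₜ* Field.absoluteGaloisGroup K)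

/-- `Π^tp_{X̲̲}` (the `Π^{(S)}` of the genuine setting) is tempered when `Π^tp_X` is — abc-iut-L2's
`DoubleUnderline.isTempered_Huu` read at `S.PiX = C.Huu`. [cite: MochizukiEtTh2009, Rmk 2.3.1 p.38] -/
theorem isTempered_piX_ofDoubleUnderline (hT : IsTempered D.PiTemp) :
    IsTempered (ofDoubleUnderline C μ hC hS hl hp2 hpl hζ hη).PiX :=
  C.isTempered_Huu hT

/-- **(a) at the genuine setting**: for tempered Galois-countable `Π^tp_X`, `ι|_Δ : Δ^tp_{X̲̲} → Δ_E` is a profinite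
completion (open augmentation by the open-mapping theorem, `isOpenMap_aug_ofDoubleUnderline_of_isTempered`).
[cite: MochizukiSemiAnbd2006, §6 p.73] -/
theorem isProfiniteCompletion_deltaCompletionMap_ofDoubleUnderline (hT : IsTempered D.PiTemp)
    [FirstCountableTopology D.PiTemp] :
    IsProfiniteCompletion ((ofDoubleUnderline C μ hC hS hl hp2 hpl hζ hη).deltaCompletionMap K eK) :=
  (ofDoubleUnderline C μ hC hS hl hp2 hpl hζ hη).isProfiniteCompletion_deltaCompletionMap K eK
    (isOpenMap_aug_ofDoubleUnderline_of_isTempered C μ hC hS hl hp2 hpl hζ hη hT) (C.isTempered_Huu hT)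

/-- `Π^tp_{X̲̲} ∩ Δ^tp_X` has FINITE INDEX in `Δ^tp_X` (`[Π^tp_X : Π^tp_{X̲̲}] = l²`).
[cite: MochizukiEtTh2009, Rmk 2.3.1 p.38] -/
theorem finiteIndex_subgroupOf_Huu_deltaTemp : (C.Huu.subgroupOf D.DeltaTemp).FiniteIndex :=
  ⟨by rw [C.index_Huu_subgroupOf_deltaTemp]; exact pow_ne_zero 2 C.l_ne_zero⟩

/-- **`Δ_{X̲̲} :=` the closure of `ι(Π^tp_{X̲̲} ∩ Δ^tp_X)` in `Δ_X` is OPEN in `Δ_X`** whenever `Δ^tp_X ↪ Δ_X` is a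
profinite completion (e.g. tempered Galois-countable `Π^tp_X`): closure of the image of an open finite-index subgroup.
[cite: MochizukiSemiAnbd2006, §6 p.69] -/
theorem isOpen_closure_map_deltaToHat_of_isProfiniteCompletion
    (hΔ : IsProfiniteCompletion D.toTemperedCurve.deltaToHat) :
    IsOpen ((((C.Huu.subgroupOf D.DeltaTemp).map D.toTemperedCurve.deltaToHat.toMonoidHom).topologicalClosure :
      Subgroup D.DeltaHat) : Set D.DeltaHat) := by
  haveI := finiteIndex_subgroupOf_Huu_deltaTemp C
  exact hΔ.isOpen_topologicalClosure_map _ C.isOpen_Huu_subgroupOf_deltaTemp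

/-- `Δ_{X̲̲}` is open in `Δ_X` for tempered Galois-countable `Π^tp_X`. [cite: MochizukiSemiAnbd2006, §6 p.69] -/
theorem isOpen_closure_map_deltaToHat_ofDoubleUnderline (hT : IsTempered D.PiTemp)
    [FirstCountableTopology D.PiTemp] :
    IsOpen ((((C.Huu.subgroupOf D.DeltaTemp).map D.toTemperedCurve.deltaToHat.toMonoidHom).topologicalClosure :
      Subgroup D.DeltaHat) : Set D.DeltaHat) :=
  isOpen_closure_map_deltaToHat_of_isProfiniteCompletion C
    (D.toTemperedCurve.isProfiniteCompletion_deltaToHat_of_isTempered hT)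

/-- **(b)+(uniqueness) at the genuine setting: `Δ_E ≃ₜ* Δ_{X̲̲}`, compatibly with `ι`.**  For an [EtTh] §1 theta
setting `D` whose `Δ^tp_X ↪ Δ_X` is a profinite completion and whose `Π^tp_X` is tempered with open augmentation
`Π^tp_{X̲̲} ↠ G_K`, the geometric part `Δ_E` of the named completion package of the genuine [IUTchII] §1 setting
`ofDoubleUnderline` is isomorphic, as a topological group and over `Δ^tp_{X̲̲}`, to the closure `Δ_{X̲̲}` of
`ι(Π^tp_{X̲̲} ∩ Δ^tp_X)` in `Δ_X` — both are profinite completions of `Δ^tp_{X̲̲}` ([SemiAnbd] §6: restriction of the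
completion `Δ^tp_X ↪ Δ_X` to the open finite-index subgroup `Π^tp_{X̲̲} ∩ Δ^tp_X`, abc-iut-L5-t11's
`ProfiniteCompletionRestrict.isProfiniteCompletion_restrict`). [cite: MochizukiSemiAnbd2006, §6 p.69, p.73] -/
theorem exists_geom_equiv_closure_ofDoubleUnderline_of (hΔ : IsProfiniteCompletion D.toTemperedCurve.deltaToHat)
    (hT : IsTempered D.PiTemp) (hopen : IsOpenMap (ofDoubleUnderline C μ hC hS hl hp2 hpl hζ hη).aug) :
    ∃ e : ((ofDoubleUnderline C μ hC hS hl hp2 hpl hζ hη).completionPackage K eK).geom ≃ₜ*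
        ((C.Huu.subgroupOf D.DeltaTemp).map D.toTemperedCurve.deltaToHat.toMonoidHom).topologicalClosure,
      ∀ x : (ofDoubleUnderline C μ hC hS hl hp2 hpl hζ hη).DeltaX,
        (((e ((ofDoubleUnderline C μ hC hS hl hp2 hpl hζ hη).deltaCompletionMap K eK x)) : D.DeltaHat) : D.PiHat) =
          D.toHat ((show C.Huu from (x : (ofDoubleUnderline C μ hC hS hl hp2 hpl hζ hη).PiX)) : D.PiTemp) := by
  haveI := finiteIndex_subgroupOf_Huu_deltaTemp C
  -- the open finite-index subgroup `H := Π^tp_{X̲̲} ∩ Δ^tp_X ≤ Δ^tp_X` and the restriction `ι_H : H → Δ_{X̲̲}`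
  set H : Subgroup D.DeltaTemp := C.Huu.subgroupOf D.DeltaTemp with hH
  set W : Subgroup D.DeltaHat := (H.map D.toTemperedCurve.deltaToHat.toMonoidHom).topologicalClosure with hWdef
  let ιH : H →ₜ* W :=
    { toFun := fun x => ⟨D.toTemperedCurve.deltaToHat x.1, Subgroup.le_topologicalClosure _ ⟨x.1, x.2, rfl⟩⟩
      map_one' := Subtype.ext (by simp only [OneMemClass.coe_one, map_one])
      map_mul' := fun a b => Subtype.ext (by simp only [Subgroup.coe_mul, map_mul])
      continuous_toFun := (D.toTemperedCurve.deltaToHat.continuous.comp continuous_subtype_val).subtype_mk _ }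
  have hιH : IsProfiniteCompletion ιH :=
    ProfiniteCompletionRestrict.isProfiniteCompletion_restrict hΔ H C.isOpen_Huu_subgroupOf_deltaTemp W rfl ιH
      (fun _ => rfl)
  -- transport to `Δ^{(S)} = Δ^tp_{X̲̲}` along `deltaXEquivSubgroupOf`, then uniqueness of profinite completions
  have h₂ := isProfiniteCompletion_comp_continuousMulEquiv hιH
    (deltaXEquivSubgroupOf C μ hC hS hl hp2 hpl hζ hη).symm
  obtain ⟨e, he⟩ := (ofDoubleUnderline C μ hC hS hl hp2 hpl hζ hη).exists_geom_continuousMulEquiv_of_isProfiniteCompletion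
    K eK hopen (C.isTempered_Huu hT) h₂
  refine ⟨e, fun x => ?_⟩
  rw [he x]
  rfl

/-- **`Δ_E ≃ₜ* Δ_{X̲̲}` at the genuine setting for tempered Galois-countable `Π^tp_X`** (the hypotheses of
`exists_geom_equiv_closure_ofDoubleUnderline_of` are then theorems: `isProfiniteCompletion_deltaToHat_of_isTempered`,
`isOpenMap_aug_ofDoubleUnderline_of_isTempered`). [cite: MochizukiSemiAnbd2006, §6 p.69, p.73] -/
theorem exists_geom_equiv_closure_ofDoubleUnderline (hT : IsTempered D.PiTemp) [FirstCountableTopology D.PiTemp] :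
    ∃ e : ((ofDoubleUnderline C μ hC hS hl hp2 hpl hζ hη).completionPackage K eK).geom ≃ₜ*
        ((C.Huu.subgroupOf D.DeltaTemp).map D.toTemperedCurve.deltaToHat.toMonoidHom).topologicalClosure,
      ∀ x : (ofDoubleUnderline C μ hC hS hl hp2 hpl hζ hη).DeltaX,
        (((e ((ofDoubleUnderline C μ hC hS hl hp2 hpl hζ hη).deltaCompletionMap K eK x)) : D.DeltaHat) : D.PiHat) =
          D.toHat ((show C.Huu from (x : (ofDoubleUnderline C μ hC hS hl hp2 hpl hζ hη).PiX)) : D.PiTemp) :=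
  exists_geom_equiv_closure_ofDoubleUnderline_of C μ hC hS hl hp2 hpl hζ hη K eK
    (D.toTemperedCurve.isProfiniteCompletion_deltaToHat_of_isTempered hT) hT
    (isOpenMap_aug_ofDoubleUnderline_of_isTempered C μ hC hS hl hp2 hpl hζ hη hT)

end Genuine

/-! ### §3. The stage-2 Tate model `modelχq p i j`: `Δ_E ≃ₜ* U` for an OPEN `U ≤ F̂₂` -/

section Model

open Literature.AnabelianGeometry.EtaleTheta Literature.AnabelianGeometry.EtaleTheta.SettingModel
open scoped Literature.AnabelianGeometry.EtaleTheta

variable (p : ℕ) [Fact p.Prime] (i j : ℤ) (hj : Even j)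
  {ED : (ThetaSetting.modelχq p i j hj).EtaleThetaData} {l : ℕ} (C : ED.DoubleUnderline l) {N : ℕ+}
  (μ : (ThetaSetting.modelχq p i j hj).CyclotomeMod l N)
  (hC : (ThetaSetting.modelχq p i j hj).Compat) (hS : (ThetaSetting.modelχq p i j hj).Sec2Hyps)
  (hl : l.Prime) (hp2 : p ≠ 2) (hpl : p ≠ l)
  (hζ : ∃ ζ : (ThetaSetting.modelχq p i j hj).K, IsPrimitiveRoot ζ (4 * l))
  {η : (C.thetaEnvData μ hC hS).PiYdd → MuN p N} (hη : η ∈ (C.thetaEnvData μ hC hS).thetaCocycles)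
  (K : Type) [Field K] [CharZero K]
  (eK : (ofDoubleUnderline C μ hC hS hl hp2 hpl hζ hη).Gk ≃ₜ* Field.absoluteGaloisGroup K)

/-- **At the stage-2 Tate model, `Δ_E` of the named completion package of the [IUTchII] §1 setting of any
`X̲̲`-choice `C` is isomorphic, as a topological group, to an OPEN subgroup `U` of `F̂₂`** (`Δ_X ≃ₜ* F̂₂` by
`deltaHatχqEquiv`; `Π^tp_X` of the model is tempered and Galois-countable, `isTempered_PiTpχq`,
`secondCountableTopology_PiTpχq`) — the binder `(U) (hU) (eΔ)` of abc-iut-w4-d044's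
`ThetaSetting.deltaX_characteristic_of_centralizer` (`n = 2`), with NO hypothesis.  `U` is the `deltaHatχqEquiv`-preimage
of `Δ_{X̲̲}`. [cite: MochizukiEtTh2009, §1 p.12] [cite: MochizukiSemiAnbd2006, §6 p.69] -/
theorem exists_geom_equiv_isOpen_freeProfinite_modelχq :
    ∃ U : Subgroup F₂hatT, IsOpen (U : Set F₂hatT) ∧
      Nonempty (((ofDoubleUnderline C μ hC hS hl hp2 hpl hζ hη).completionPackage K eK).geom ≃ₜ* U) := by
  haveI : SecondCountableTopology (PiTpχq p i j) := secondCountableTopology_PiTpχq p i j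
  haveI : FirstCountableTopology (ThetaSetting.modelχq p i j hj).PiTemp :=
    (inferInstance : FirstCountableTopology (PiTpχq p i j))
  have hT : IsTempered (ThetaSetting.modelχq p i j hj).PiTemp := isTempered_PiTpχq p i j
  obtain ⟨e, -⟩ := exists_geom_equiv_closure_ofDoubleUnderline C μ hC hS hl hp2 hpl hζ hη K eK hT
  have hWopen := isOpen_closure_map_deltaToHat_ofDoubleUnderline C hT
  set W : Subgroup (ThetaSetting.modelχq p i j hj).DeltaHat :=
    ((C.Huu.subgroupOf (ThetaSetting.modelχq p i j hj).DeltaTemp).map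
      (ThetaSetting.modelχq p i j hj).toTemperedCurve.deltaToHat.toMonoidHom).topologicalClosure with hWdef
  -- read `W ≤ Δ_X` inside `F̂₂` through `deltaHatχqEquiv : F̂₂ ≃ₜ* Δ_X`
  let f : F₂hatT ≃ₜ* (curveχq p i j).DeltaHat := deltaHatχqEquiv p i j
  refine ⟨W.comap f.toMulEquiv.toMonoidHom, ?_, ⟨e.trans ?_⟩⟩
  · exact hWopen.preimage f.continuous
  · exact
      { toFun := fun w => ⟨f.symm w.1, by
          change f (f.symm w.1) ∈ W
          rw [f.apply_symm_apply]
          exact w.2⟩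
        invFun := fun u => ⟨f u.1, u.2⟩
        left_inv := fun w => Subtype.ext (f.apply_symm_apply w.1)
        right_inv := fun u => Subtype.ext (f.symm_apply_apply u.1)
        map_mul' := fun a b => Subtype.ext (map_mul f.symm a.1 b.1)
        continuous_toFun := (f.symm.continuous.comp continuous_subtype_val).subtype_mk fun w => by
          change f (f.symm w.1) ∈ W
          rw [f.apply_symm_apply]
          exact w.2
        continuous_invFun := (f.continuous.comp continuous_subtype_val).subtype_mk fun u => u.2 }

end Model

end ThetaSetting

/-! ### §4. At abc-iut-w4-d030's `EtaleLevels.setting` (the `S` of the Cor. 1.11 / Cor. 1.12 (iii) chain) -/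

namespace EtaleLevels

open Literature.AnabelianGeometry.EtaleTheta Literature.AnabelianGeometry.EtaleTheta.SettingModel
open scoped Literature.AnabelianGeometry.EtaleTheta

section Genuine

variable {p : ℕ} [Fact p.Prime] {D : Literature.AnabelianGeometry.EtaleTheta.ThetaSetting p}
  {E : D.EtaleThetaData} {l : ℕ} (C : E.DoubleUnderline l) (hC : D.Compat) (hS : D.Sec2Hyps)
  (hl : l.Prime) (hp2 : p ≠ 2) (hpl : p ≠ l) (hζ : ∃ ζ : D.K, IsPrimitiveRoot ζ (4 * l))
  (mods : ∀ M : ℕ+, D.CyclotomeMod l M)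
  (f : contCocycles D.toTheta D.DeltaTheta C.GtpYdduu) (hf : f ∈ C.rootCocycles hC)
  (K : Type) [Field K] [CharZero K]
  (eK : (setting C hC hS hl hp2 hpl hζ mods f hf).Gk ≃ₜ* Field.absoluteGaloisGroup K)

/-- (a) at `EtaleLevels.setting`: `ι|_Δ : Δ^tp_{X̲̲} → Δ_E` is a profinite completion, for tempered Galois-countable
`Π^tp_X`. [cite: MochizukiSemiAnbd2006, §6 p.73] -/
theorem isProfiniteCompletion_deltaCompletionMap_setting (hT : IsTempered D.PiTemp)
    [FirstCountableTopology D.PiTemp] :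
    IsProfiniteCompletion ((setting C hC hS hl hp2 hpl hζ mods f hf).deltaCompletionMap K eK) :=
  ThetaSetting.isProfiniteCompletion_deltaCompletionMap_ofDoubleUnderline C (mods 1) hC hS hl hp2 hpl hζ
    (eta0_mem C hC hS mods f hf 1) K eK hT

/-- `Δ_E ≃ₜ* Δ_{X̲̲}` (the closure of `ι(Π^tp_{X̲̲} ∩ Δ^tp_X)` in `Δ_X`, open in `Δ_X`), compatibly with `ι`, at
`EtaleLevels.setting`, for tempered Galois-countable `Π^tp_X`. [cite: MochizukiSemiAnbd2006, §6 p.69, p.73] -/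
theorem exists_geom_equiv_closure_setting (hT : IsTempered D.PiTemp) [FirstCountableTopology D.PiTemp] :
    ∃ e : ((setting C hC hS hl hp2 hpl hζ mods f hf).completionPackage K eK).geom ≃ₜ*
        ((C.Huu.subgroupOf D.DeltaTemp).map D.toTemperedCurve.deltaToHat.toMonoidHom).topologicalClosure,
      ∀ x : (setting C hC hS hl hp2 hpl hζ mods f hf).DeltaX,
        (((e ((setting C hC hS hl hp2 hpl hζ mods f hf).deltaCompletionMap K eK x)) : D.DeltaHat) : D.PiHat) =
          D.toHat ((show C.Huu from (x : (setting C hC hS hl hp2 hpl hζ mods f hf).PiX)) : D.PiTemp) :=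
  ThetaSetting.exists_geom_equiv_closure_ofDoubleUnderline C (mods 1) hC hS hl hp2 hpl hζ
    (eta0_mem C hC hS mods f hf 1) K eK hT

end Genuine

section Model

variable (p : ℕ) [Fact p.Prime] (i j : ℤ) (hj : Even j)
  {E : (ThetaSetting.modelχq p i j hj).EtaleThetaData} {l : ℕ} (C : E.DoubleUnderline l)
  (hC : (ThetaSetting.modelχq p i j hj).Compat) (hS : (ThetaSetting.modelχq p i j hj).Sec2Hyps)
  (hl : l.Prime) (hp2 : p ≠ 2) (hpl : p ≠ l)
  (hζ : ∃ ζ : (ThetaSetting.modelχq p i j hj).K, IsPrimitiveRoot ζ (4 * l))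
  (mods : ∀ M : ℕ+, (ThetaSetting.modelχq p i j hj).CyclotomeMod l M)
  (f : contCocycles (ThetaSetting.modelχq p i j hj).toTheta (ThetaSetting.modelχq p i j hj).DeltaTheta C.GtpYdduu)
  (hf : f ∈ C.rootCocycles hC)
  (K : Type) [Field K] [CharZero K]
  (eK : (setting C hC hS hl hp2 hpl hζ mods f hf).Gk ≃ₜ* Field.absoluteGaloisGroup K)

/-- **THE «(ii-b)-IDENT» BINDER AT THE STAGE-2 TATE MODEL, NO HYPOTHESIS**: for the [IUTchII] §1 setting
`EtaleLevels.setting C …` over `D := ThetaSetting.modelχq p i j` (every `(i, j)`; the Tate instance is `(1, 2)`) and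
any identification `eK : G_k ⥲ Gal(K̄/K)`, there is an OPEN subgroup `U ≤ F̂₂` with
`Δ_E := (S.completionPackage K eK).geom ≃ₜ* U`. [cite: MochizukiEtTh2009, §1 p.12] [cite: MochizukiSemiAnbd2006, §6 p.69] -/
theorem exists_geom_equiv_isOpen_freeProfinite_modelχq :
    ∃ U : Subgroup F₂hatT, IsOpen (U : Set F₂hatT) ∧
      Nonempty (((setting C hC hS hl hp2 hpl hζ mods f hf).completionPackage K eK).geom ≃ₜ* U) :=
  ThetaSetting.exists_geom_equiv_isOpen_freeProfinite_modelχq p i j hj C (mods 1) hC hS hl hp2 hpl hζ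
    (eta0_mem C hC hS mods f hf 1) K eK

end Model

end EtaleLevels

end Literature.IUT.HodgeArakelov

end
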